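import Literature.NumberTheory.Li1992.RallisLocalFactorNonsplitPlace
import Literature.NumberTheory.Automorphic.Liu2021.Def411WeilCarriersSurvivalNonsplit
import HarnessLib

/-!
# [Li1992, Thm 2.1 (27)] — the UNRAMIFIED local factor at a NON-SPLIT place: the spherical vector `1_{𝒪_vᴺ}` is the test vector

J.-S. Li, J. reine angew. Math. **428** (1992), Thm 2.1 second display (27) p. 184 (the Euler factorisation of Rallis' inner product
formula) and p. 184 L-3 («for almost all `v` the local integral is computed with the unramified data»); [TateThesis1967, §3.2 Lemma 3.2.1]
(a continuous character of a restricted product is unramified at almost every place).  Sequel of `RallisLocalFactorNonsplitPlace.lean`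
(the local factor at a non-split place is non-zero for SOME test vector): for the EULER PRODUCT over the places one needs, at almost every
place, the factor AT THE DISTINGUISHED VECTOR `Φ_v = Ψ_v = 1_{𝒪_vᴺ}` of the restricted tensor product `𝒮((𝔸_F^∞)ᴺ) = ⊗'_v 𝒮(F_vᴺ)`.  At the
NON-SPLIT places this is elementary and entirely in the tree's currency:

* §1 `integral_coeff_mul_conj_eq_of_fixed` (generic, kernel): if `Φ` is FIXED by `ω(G)` and `χ ≡ 1` then
  `∫_G ⟨ω(h)Φ, Ψ⟩ conj χ(h) dh = dh(G) · ⟨Φ, Ψ⟩` (the eigenvector identity of the prequel at the trivial character);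
  `integral_unitVec_mul_conj_unitVec`: `⟨1_{𝒪ᴺ}, 1_{𝒪ᴺ}⟩ = μ_X(𝒪_vᴺ)`, non-zero when `μ_X` charges open sets.
* §2 **`FinLocalSplittings.eventually_unitVec_fixed_and_localChar_eq_one_of_nonsplit`** (kernel): for a family `𝓢` of local splittings of
  `U(J)(F_v)` ([GelbartRogawski1991, Prop. 3.1.1]) and a continuous character `χ₁` of the centre `E¹(𝔸_{F,f})`: for all but finitely many `v`,
  IF `v` is non-split THEN the whole torus `U(J₁)(F_v) = E_v¹` (integral and compact: ★ `localInt_one_eq_top_of_smul_eq`) FIXES `1_{𝒪_vᴺ}`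
  through the centre (★ `𝓢.unramified`, ★ `localCenter_mapsTo_localInt`) and `χ_{1,v} ≡ 1` (★ `eventually_localCharOfCenter_eq_one`).
* §3 **`FinLocalSplittings.eventually_localFactor_unitVec_of_nonsplit`**: hence at almost every non-split place, for ANY measures
  `dh` on `U(J₁)(F_v)` and `μ_X` on `F_vᴺ`, the local factor of (27) at the spherical data is
  `∫_{U(J₁)(F_v)} ⟨ω_v(u·1) 1_{𝒪ᴺ}, 1_{𝒪ᴺ}⟩ conj χ_{1,v}(u) du = dh(U(J₁)(F_v)) · μ_X(𝒪_vᴺ)` (`= 1` for the normalised measures),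
  the unramified non-split clause (F4) of the finite half of the cell's S4′(ii) assembly (`F0/P4/SEAT-ii-MEMO-S4ii.v1`).

KERNEL only: theorems, no definition, no named fact, no `sorry`.  Cell hodgecm-mathlib, FLOOR 0, programme P4, crux item H413
(`--supports stmt-HodgeConjecture-24833`).  The SPLIT places (where `E_v¹ ≅ F_vˣ` is not compact and the factor at the spherical vector is a
Tate-type sum) are NOT here.  HC_CM is proved only modulo the printed citations until rung 0 closes; nothing here is a claim about them.

## References
* [Li1992] J.-S. Li, J. reine angew. Math. 428 (1992) 177–217 — Thm 2.1 (27) p. 184; §5 p. 206.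
* [TateThesis1967] J. Tate, in Cassels–Fröhlich, *Algebraic Number Theory* (1967), Ch. XV §3.2 Lemma 3.2.1.
* [GelbartRogawski1991] S. Gelbart, J. Rogawski, Invent. Math. 105 (1991), §3.1 Prop. 3.1.1 p. 455, (3.1.3) p. 456.
* [Liu2021] Y. Liu, Camb. J. Math. 9 (2021), Def. 4.11 (l. 2092–2096).
-/

set_option autoImplicit false

noncomputable section

open NumberField IsDedekindDomain MeasureTheory Filter Set
open scoped Matrix NNReal Topology ComplexConjugate
open Literature.RepresentationTheory Literature.RepresentationTheory.HeisenbergGroup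
open Literature.NumberTheory.Automorphic
open Literature.NumberTheory.Automorphic.UnitaryGroup
open Literature.NumberTheory.Automorphic.Liu2021
open Literature.NumberTheory.Weil1964

/-! ## §1 The factor at a fixed vector with trivial character; `⟨1_{𝒪ᴺ}, 1_{𝒪ᴺ}⟩ = μ_X(𝒪ᴺ)` -/

namespace Literature.NumberTheory.Li1992

section Generic

variable {G : Type*} [Group G] [MeasurableSpace G] {X : Type*} [TopologicalSpace X] [MeasurableSpace X]

/-- **`∫_G ⟨ω(h)Φ, Ψ⟩ conj χ(h) dh = dh(G) · ⟨Φ, Ψ⟩` for a vector `Φ` FIXED by `ω(G)` and `χ ≡ 1`** (the unramified shape of the local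
factor of (27): spherical vector, unramified character). [cite: Li1992, Thm 2.1 (27) p. 184] -/
theorem integral_coeff_mul_conj_eq_of_fixed (dh : Measure G) (μX : Measure X)
    (ω : Representation ℂ G ↥(SchwartzBruhat X)) (χ : G →* ℂˣ) (hχ : ∀ h, χ h = 1)
    {Φ : ↥(SchwartzBruhat X)} (hΦ : ∀ h, ω h Φ = Φ) (Ψ : ↥(SchwartzBruhat X)) :
    ∫ h, (∫ x, ((ω h Φ : ↥(SchwartzBruhat X)) : X → ℂ) x * conj (((Ψ : ↥(SchwartzBruhat X)) : X → ℂ) x) ∂μX) *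
        conj (((χ h : ℂˣ) : ℂ)) ∂dh =
      (dh.real Set.univ : ℂ) * ∫ x, ((Φ : ↥(SchwartzBruhat X)) : X → ℂ) x * conj (((Ψ : ↥(SchwartzBruhat X)) : X → ℂ) x) ∂μX :=
  integral_coeff_mul_conj_eq_of_eigenvector dh μX ω χ (fun h => by rw [hχ h, Units.val_one, norm_one])
    (fun h => by rw [hΦ h, hχ h, Units.val_one, one_smul]) Ψ

end Generic

section UnitVec

variable (F : Type) [Field F] [NumberField F] (N : ℕ) (v : HeightOneSpectrum (𝓞 F))
  [MeasurableSpace (Fin N → v.adicCompletion F)]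

/-- **`⟨1_{𝒪_vᴺ}, 1_{𝒪_vᴺ}⟩ = μ_X(𝒪_vᴺ)`**: the self-pairing of the spherical vector is the measure of the integral box (`1` for the
normalised Haar measure). [cite: TateThesis1967, §3.2] -/
theorem integral_unitVec_mul_conj_unitVec (μX : Measure (Fin N → v.adicCompletion F)) (hm : MeasurableSet (integralBox F (Fin N) v)) :
    ∫ x, ((unitVec F (Fin N) v : ↥(SchwartzBruhat (Fin N → v.adicCompletion F))) : (Fin N → v.adicCompletion F) → ℂ) x *
        conj (((unitVec F (Fin N) v : ↥(SchwartzBruhat (Fin N → v.adicCompletion F))) : (Fin N → v.adicCompletion F) → ℂ) x) ∂μX =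
      (μX.real (integralBox F (Fin N) v) : ℂ) := by
  have h : ∀ x, ((unitVec F (Fin N) v : ↥(SchwartzBruhat (Fin N → v.adicCompletion F))) : (Fin N → v.adicCompletion F) → ℂ) x *
      conj (((unitVec F (Fin N) v : ↥(SchwartzBruhat (Fin N → v.adicCompletion F))) : (Fin N → v.adicCompletion F) → ℂ) x) =
      (integralBox F (Fin N) v).indicator (fun _ => (1 : ℂ)) x := by
    intro x
    rw [coe_unitVec]
    by_cases hx : x ∈ integralBox F (Fin N) v
    · simp [Set.indicator_of_mem hx]
    · simp [Set.indicator_of_notMem hx]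
  simp_rw [h]
  rw [integral_indicator_const _ hm, Complex.real_smul, mul_one]

/-- … and it is NON-ZERO when `μ_X` charges open sets and is finite on `𝒪_vᴺ` (the box is open, compact and contains `0`).
[cite: TateThesis1967, §3.2] -/
theorem integral_unitVec_mul_conj_unitVec_ne_zero (μX : Measure (Fin N → v.adicCompletion F)) [μX.IsOpenPosMeasure]
    [IsFiniteMeasureOnCompacts μX] (hm : MeasurableSet (integralBox F (Fin N) v)) :
    ∫ x, ((unitVec F (Fin N) v : ↥(SchwartzBruhat (Fin N → v.adicCompletion F))) : (Fin N → v.adicCompletion F) → ℂ) x *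
        conj (((unitVec F (Fin N) v : ↥(SchwartzBruhat (Fin N → v.adicCompletion F))) : (Fin N → v.adicCompletion F) → ℂ) x) ∂μX ≠ 0 := by
  rw [integral_unitVec_mul_conj_unitVec F N v μX hm, Complex.ofReal_ne_zero]
  have hpos : 0 < μX (integralBox F (Fin N) v) := (isOpen_integralBox F (Fin N) v).measure_pos μX ⟨0, zero_mem_integralBox F (Fin N) v⟩
  exact (ENNReal.toReal_pos hpos.ne' (isCompact_integralBox F (Fin N) v).measure_lt_top.ne).ne'

end UnitVec

end Literature.NumberTheory.Li1992

/-! ## §2 At almost every NON-SPLIT place the torus fixes `1_{𝒪_vᴺ}` and `χ_{1,v}` is trivial -/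

namespace Literature.NumberTheory.GelbartRogawski1991.UnitaryDualPair.LocalSplitting.FinLocalSplittings

variable {F : Type} [Field F] [NumberField F] {E : Type} [Field E] [NumberField E] [Algebra F E]
  [Algebra.IsQuadraticExtension F E] {c : E ≃ₐ[F] E} {N : ℕ} {δ : E} {hcδ : c δ = -δ} {hδ : δ ≠ 0} {d : F}
  {hd : δ * δ = algebraMap F E d} {T : Matrix (Fin N) (Fin N) F} {hT : T.IsSymm}
  {J : Matrix (Fin N) (Fin N) E} {hJ : J = T.map (algebraMap F E)}
  (𝓢 : FinLocalSplittings F E c N hcδ hδ hd T hT hJ) (J₁ : Matrix (Fin 1) (Fin 1) E) (hJ₁ : J₁ 0 0 ≠ 0)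

/-- **At almost every non-split place the whole torus `U(J₁)(F_v) = E_v¹` FIXES the spherical vector and `χ_{1,v} ≡ 1`.**  For a family
`𝓢` of local splittings and a continuous character `χ₁` of `E¹(𝔸_{F,f})`: for all but finitely many `v`, if `v` is non-split (`c • w = w` for a
place `w ∣ v`) then `ω_v(u · 1_N) 1_{𝒪_vᴺ} = 1_{𝒪_vᴺ}` and `χ_{1,v}(u) = 1` for EVERY `u ∈ U(J₁)(F_v)` — off a finite set `U(J)(𝒪_v)` fixes
`1_{𝒪_vᴺ}` (the unramified clause of `𝓢`) and `χ_{1,v}` is trivial on `U(J₁)(𝒪_v)` ([TateThesis1967, Lemma 3.2.1]), and at a non-split `v` the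
torus is its own integral subgroup. [cite: GelbartRogawski1991, §3.1 (3.1.3) p. 456] [cite: TateThesis1967, §3.2 Lemma 3.2.1] -/
theorem eventually_unitVec_fixed_and_localChar_eq_one_of_nonsplit {χ₁ : finAdelicOne F E c →* ℂˣ} (hχ₁ : Continuous χ₁) :
    ∀ᶠ v : HeightOneSpectrum (𝓞 F) in cofinite, ∀ w : PlacesOver E v, c • w.1 = w.1 →
      (∀ u : localPi E c 1 J₁ v, 𝓢.omegaLoc v (localCenter E c N J J₁ hJ₁ v u) (unitVec F (Fin N) v) = unitVec F (Fin N) v) ∧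
        ∀ u : localPi E c 1 J₁ v, localCharOfCenter F E c J₁ hJ₁ χ₁ v u = 1 := by
  -- `c δ = -δ ≠ 0` forces `c ≠ 1`
  have hc : c ≠ 1 := by
    rintro rfl
    exact hδ (self_eq_neg.1 (by simpa only [AlgEquiv.one_apply] using hcδ))
  filter_upwards [𝓢.unramified, eventually_localCharOfCenter_eq_one F E c J₁ hJ₁ hχ₁] with v hunr hχv
  intro w hw
  have hmem : ∀ u : localPi E c 1 J₁ v, u ∈ localInt E c 1 J₁ v := fun u => by
    rw [localInt_one_eq_top_of_smul_eq c J₁ hc hJ₁ w hw]; exact Subgroup.mem_top u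
  exact ⟨fun u => hunr _ (localCenter_mapsTo_localInt E c N J J₁ hJ₁ v (hmem u)), fun u => hχv u (hmem u)⟩

/-! ## §3 The unramified local factor at a non-split place -/

/-- **THE LOCAL FACTOR OF (27) AT THE SPHERICAL DATA, NON-SPLIT UNRAMIFIED PLACES.**  For a family `𝓢` of local splittings of `U(J)(F_v)`
and a continuous character `χ₁` of `E¹(𝔸_{F,f})`: for all but finitely many `v`, if `v` is non-split then for ANY measure `dh` on the torus
`U(J₁)(F_v)` and ANY measure `μ_X` on `F_vᴺ` with `𝒪_vᴺ` measurable,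
`∫_{U(J₁)(F_v)} ⟨ω_v(u·1) 1_{𝒪ᴺ}, 1_{𝒪ᴺ}⟩ conj χ_{1,v}(u) du = dh(U(J₁)(F_v)) · μ_X(𝒪_vᴺ)` (`⟨Φ, Ψ⟩ = ∫ Φ Ψ̄ dμ_X`) — `= 1` for the
normalised measures, and non-zero whenever `dh ≠ 0` and `μ_X` charges open sets. [cite: Li1992, Thm 2.1 (27) p. 184] [cite: TateThesis1967, §3.2 Lemma 3.2.1] -/
theorem eventually_localFactor_unitVec_of_nonsplit {χ₁ : finAdelicOne F E c →* ℂˣ} (hχ₁ : Continuous χ₁) :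
    ∀ᶠ v : HeightOneSpectrum (𝓞 F) in cofinite, ∀ w : PlacesOver E v, c • w.1 = w.1 →
      ∀ [MeasurableSpace (localPi E c 1 J₁ v)] (dh : Measure (localPi E c 1 J₁ v))
        [MeasurableSpace (Fin N → v.adicCompletion F)] (μX : Measure (Fin N → v.adicCompletion F)),
        MeasurableSet (integralBox F (Fin N) v) →
        ∫ u, (∫ x, ((𝓢.omegaLoc v (localCenter E c N J J₁ hJ₁ v u) (unitVec F (Fin N) v) :
              ↥(SchwartzBruhat (Fin N → v.adicCompletion F))) : (Fin N → v.adicCompletion F) → ℂ) x *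
            conj (((unitVec F (Fin N) v : ↥(SchwartzBruhat (Fin N → v.adicCompletion F))) : (Fin N → v.adicCompletion F) → ℂ) x) ∂μX) *
            conj (((localCharOfCenter F E c J₁ hJ₁ χ₁ v u : ℂˣ) : ℂ)) ∂dh =
          (dh.real Set.univ : ℂ) * (μX.real (integralBox F (Fin N) v) : ℂ) := by
  filter_upwards [𝓢.eventually_unitVec_fixed_and_localChar_eq_one_of_nonsplit J₁ hJ₁ hχ₁] with v hv
  intro w hw _ dh _ μX hm
  obtain ⟨hfix, htriv⟩ := hv w hw
  rw [← Li1992.integral_unitVec_mul_conj_unitVec F N v μX hm]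
  exact Li1992.integral_coeff_mul_conj_eq_of_fixed dh μX
    (show Representation ℂ (localPi E c 1 J₁ v) ↥(SchwartzBruhat (Fin N → v.adicCompletion F)) from
      (𝓢.omegaLoc v).comp (localCenter E c N J J₁ hJ₁ v))
    (localCharOfCenter F E c J₁ hJ₁ χ₁ v) htriv (Φ := unitVec F (Fin N) v) (fun u => hfix u) (unitVec F (Fin N) v)

end Literature.NumberTheory.GelbartRogawski1991.UnitaryDualPair.LocalSplitting.FinLocalSplittings

end
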